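import Literature.NumberTheory.EllipticCurves.SexticTwistThetaDictionaryGoodTwo
import Literature.NumberTheory.EllipticCurves.AnalyticRank
import HarnessLib

/-!
# `L(E^k, s)` is entire for every Mordell curve `E^k : y² = x³ + k`, `k ≠ 0` free of sixth powers (Ireland–Rosen, Ch. 18 §7 with §5 Thm. 6)

Topic `Literature/NumberTheory/EllipticCurves`, namespace `Literature.NumberTheory.EllipticCurves.SexticTwist` (sequel to
`SexticTwistThetaDictionary`, `SexticTwistThetaDictionaryGoodTwo`). THEOREMS ONLY (no definition, no named fact).

Source: K. Ireland, M. Rosen, *A Classical Introduction to Modern Number Theory*, 2nd ed., GTM 84 (1990), Ch. 18 §7 («`L(E, s) = L(s, χ)`»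
for `E : y² = x³ + D` and the Hecke character of `ℚ(√−3)` attached to the sextic residue symbol) with §5 Theorem 6 (Hecke: «`L(s, χ)` can be
analytically continued to an entire function»). The tree proves the twisted identity `Σ_n c(n) a_n(E^k) n⁻ˢ = (4^s/2)·Θ-L_{2M}(Φ♯)(s)` for
`Re s > 3/2` together with an entire continuation of the right-hand side — `SexticTwist.exists_differentiable_twist` for `k` outside the
class `k = 16u`, `u ≡ 1 (mod 4)`, and `SexticTwist.lSeries_twist_eq_thetaLFunction_good` on that class (with the continuation of the
binary theta series `BinaryTheta.differentiable_thetaLFunction`). This file reads off the untwisted case `m = 1`, `c = 1` in the BSD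
prelude's vocabulary (`WeierstrassCurve.HasEntireLFunction`: `W.LSeries` has an entire continuation from `Re s > 3/2`, Silverman AEC C.16):

* `exists_differentiable_twist_good` — the `k = 16u`, `u ≡ 1 (mod 4)` twin of `exists_differentiable_twist`;
* `exists_differentiable_twist_all` — both classes together;
* ★ `hasEntireLFunction` — **`(mordellCurve k).HasEntireLFunction`** for every `k ≠ 0` free of sixth powers.

This discharges the Deuring–Hecke continuation leaf `hasEntireLFunction_of_j_mem_maximalCMJInvariants` on the whole `j = 0` family of
sixth-power-free models `y² = x³ + k` (the twin of `QuarticTwist.hasEntireLFunction` for `j = 1728` and of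
`hasEntireLFunction_congruentNumberCurve_holds`). Nothing about BSD is proved here.

## References
* K. Ireland, M. Rosen, *A Classical Introduction to Modern Number Theory*, 2nd ed., GTM 84 (1990), Ch. 18 §5 Thm. 6, §7. [IrelandRosen1990]
* E. Hecke, *Eine neue Art von Zetafunktionen und ihre Beziehungen zur Verteilung der Primzahlen* II, Math. Z. 6 (1920), §9. [Hecke1920]
* J. H. Silverman, *The Arithmetic of Elliptic Curves*, 2nd ed., GTM 106 (2009), App. C §16. [SilvermanAEC2009]

## Mathlib / tree search
Tree: `SexticTwist.exists_differentiable_twist`, `SexticTwist.lSeries_twist_eq_thetaLFunction_good`, `BinaryTheta.differentiable_thetaLFunction`,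
`WeierstrassCurve.HasEntireLFunction` (`AnalyticRank`), `QuarticTwist.hasEntireLFunction` (the `j = 1728` twin). Mathlib: `WeierstrassCurve.LSeries`,
`LSeries_congr`.
-/

noncomputable section

open scoped Classical

open Complex

namespace Literature.NumberTheory.EllipticCurves

namespace SexticTwist

open WeierstrassCurve Literature.NumberTheory.LFunctions

variable {k : ℤ} {m : ℕ}

/-- **An entire continuation of `Σ_n c(n) a_n(E^k) n⁻ˢ` on the class `k = 16u`, `u ≡ 1 (mod 4)`** (good reduction at `2`): the
dictionary `lSeries_twist_eq_thetaLFunction_good` with Hecke's continuation of the binary theta series.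
[cite: IrelandRosen1990, Ch. 18 §5 Theorem 6 and §7] [cite: Hecke1920, §9] -/
theorem exists_differentiable_twist_good {u : ℤ} (hu4 : u % 4 = 1) (hku : k = 16 * u)
    (h6 : ∀ q : ℕ, q.Prime → ¬ (q : ℤ) ^ 6 ∣ k) [NeZero m] (c : ZMod m → ℂ) :
    ∃ L : ℂ → ℂ, Differentiable ℂ L ∧
      ∀ s : ℂ, 3 / 2 < s.re → L s = LSeries (fun n : ℕ ↦ c (n : ZMod m) * ((mordellCurve (k : ℚ)).LFunction n : ℂ)) s := by
  obtain ⟨M, hM0, h2M0, Φ, -, -, -, -, hL⟩ := lSeries_twist_eq_thetaLFunction_good hu4 hku h6 c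
  refine ⟨fun s ↦ (4 : ℂ) ^ s / 2 * BinaryTheta.thetaLFunction 3 (2 * M) 1 (-((Real.sqrt 3 : ℂ) * I)) (QuadOrder.parityLift Φ) s,
    ?_, fun s hs ↦ (hL s hs).symm⟩
  refine Differentiable.mul (Differentiable.div_const (fun s ↦ ?_) 2) (BinaryTheta.differentiable_thetaLFunction 3 (2 * M) 1 _ _)
  exact differentiableAt_id.const_cpow (Or.inl (by norm_num))

/-- **An entire continuation of `Σ_n c(n) a_n(E^k) n⁻ˢ` for every `k ≠ 0` free of sixth powers** (both classes).
[cite: IrelandRosen1990, Ch. 18 §5 Theorem 6 and §7] -/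
theorem exists_differentiable_twist_all (hk : k ≠ 0) (h6 : ∀ q : ℕ, q.Prime → ¬ (q : ℤ) ^ 6 ∣ k) [NeZero m] (c : ZMod m → ℂ) :
    ∃ L : ℂ → ℂ, Differentiable ℂ L ∧
      ∀ s : ℂ, 3 / 2 < s.re → L s = LSeries (fun n : ℕ ↦ c (n : ZMod m) * ((mordellCurve (k : ℚ)).LFunction n : ℂ)) s := by
  by_cases h2 : ∃ u : ℤ, u % 4 = 1 ∧ k = 16 * u
  · obtain ⟨u, hu4, hku⟩ := h2
    exact exists_differentiable_twist_good hu4 hku h6 c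
  · exact exists_differentiable_twist hk h6 h2 c

/-- ★ **`L(E^k, s)` is entire** for the Mordell curve `E^k : y² = x³ + k`, `k ≠ 0` free of sixth powers (the whole sixth-power-free `j = 0`
family): the untwisted case `m = 1`, `c = 1` of the dictionary, in the BSD prelude's vocabulary `WeierstrassCurve.HasEntireLFunction`.
[cite: IrelandRosen1990, Ch. 18 §5 Theorem 6 and §7] -/
theorem hasEntireLFunction (hk : k ≠ 0) (h6 : ∀ q : ℕ, q.Prime → ¬ (q : ℤ) ^ 6 ∣ k) :
    (mordellCurve (k : ℚ)).HasEntireLFunction := by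
  obtain ⟨L, hL, hLs⟩ := exists_differentiable_twist_all (m := 1) hk h6 (fun _ ↦ (1 : ℂ))
  refine ⟨L, hL, fun s hs ↦ ?_⟩
  rw [hLs s hs, WeierstrassCurve.LSeries]
  exact LSeries_congr (fun {n} _ ↦ by simp) s

end SexticTwist

end Literature.NumberTheory.EllipticCurves

end
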